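import Literature.Analysis.FluidPDE.PassiveScalarEnergySlice
import Literature.Analysis.FluidPDE.TorusClassicalLerayHopfProofs
import Literature.Analysis.FunctionSpaces.TorusSpaceTime
import Literature.Analysis.FunctionSpaces.TorusFluidGlue
import HarnessLib

/-!
# `L²` bookkeeping on the flat torus: norms from energies, pairings, Fourier modes, energies of smooth fields

Topic `Literature/Analysis/FluidPDE` (support file for the `2½`-dimensional assembly of
Cheskidov 2023, Thm. 2.1, `Literature/Barriers/AnomalousDissipation/…Proofs.lean`). Elementary
facts through which the energy statements of Cheskidov's construction (unit `L²` norms,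
`L²`-convergence `θ^m - ρ^m → 0`, vanishing `Ḣ⁻¹` norms of the mixed scalars, weak convergence
tested against `L²` functions) are converted into one another:

* `eLpNorm_two_eq_ofReal_sqrt_integral_sq` — `‖f‖_{L²} = ofReal √(∫ f²)` for real `f ∈ L²`;
* `abs_integral_inner_le_sqrt_mul_sqrt` — Cauchy–Schwarz for pairings `∫ ⟪a, w⟫` of `L²` fields;
* `Torus.tendsto_mFourierCoeff_of_tendsto_integral_mul` — weak convergence to `0` against
  continuous real test functions gives vanishing Fourier coefficients;
* `Torus.enorm_mFourierCoeff_le_of_ne_zero` — `‖𝓕F(k)‖ ≤ |k| · ‖F‖_{Ḣ⁻¹}` for `k ≠ 0`, whence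
  `Torus.tendsto_mFourierCoeff_of_tendsto_eHomSobolevSeminorm` (Cheskidov 2023, (3.6) and (3.9):
  "`‖ρ(t)‖_{Ḣ⁻¹} → 0` and zero mean, hence `ρ(t) ⇀ 0`");
* `Torus.IsSmoothSpaceTimeOn.continuousOn_scalarGradNormSq` / `continuousOn_integral_norm_sq` —
  energies and scalar enstrophies of jointly smooth fields are continuous in time (so that their
  time integrals are genuine; the vector enstrophy is the accepted
  `IsSmoothSpaceTimeOn.continuousOn_gradNormSq` of `TorusClassicalLerayHopfProofs`).

## References

* A. Cheskidov, arXiv:2311.04182 (2023), Thm. 3.1 (b), (3.6), (3.9)–(3.10), §4.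
* L. Grafakos, *Classical Fourier Analysis*, 3rd ed. (2014), Prop. 3.2.7 (Fourier coefficients
  and Sobolev-type weights).
-/

noncomputable section

open MeasureTheory Set Filter UnitAddTorus
open _root_.Topology
open scoped ENNReal NNReal InnerProductSpace ComplexConjugate

namespace Literature.Analysis.FluidPDE

/-! ## `L²` norms from energies; Cauchy–Schwarz for pairings -/

section General

variable {α : Type*} [MeasurableSpace α] {μ : Measure α}

/-- `‖f‖_{L²} = ofReal √(∫ f²)` for real `f ∈ L²`. [folklore] -/
theorem eLpNorm_two_eq_ofReal_sqrt_integral_sq {f : α → ℝ} (hf : MemLp f 2 μ) :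
    eLpNorm f 2 μ = ENNReal.ofReal (Real.sqrt (∫ x, f x ^ 2 ∂μ)) := by
  rw [hf.eLpNorm_eq_integral_rpow_norm two_ne_zero ENNReal.ofNat_ne_top, Real.sqrt_eq_rpow]
  simp only [ENNReal.toReal_ofNat, Real.rpow_two, Real.norm_eq_abs, sq_abs, one_div]

/-- A real `L²` function with `∫ f² = 1` has `‖f‖_{L²} = 1`. [folklore] -/
theorem eLpNorm_two_eq_one_of_integral_sq {f : α → ℝ} (hf : MemLp f 2 μ) (h : ∫ x, f x ^ 2 ∂μ = 1) :
    eLpNorm f 2 μ = 1 := by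
  rw [eLpNorm_two_eq_ofReal_sqrt_integral_sq hf, h, Real.sqrt_one, ENNReal.ofReal_one]

/-- **Cauchy–Schwarz for pairings of `L²` fields**: `|∫ ⟪a, w⟫| ≤ √(∫ ‖a‖²) · √(∫ ‖w‖²)`. [folklore] -/
theorem abs_integral_inner_le_sqrt_mul_sqrt {E : Type*} [NormedAddCommGroup E]
    [InnerProductSpace ℝ E] {a w : α → E} (ha : MemLp a 2 μ) (hw : MemLp w 2 μ) :
    |∫ x, ⟪a x, w x⟫_ℝ ∂μ| ≤ Real.sqrt (∫ x, ‖a x‖ ^ 2 ∂μ) * Real.sqrt (∫ x, ‖w x‖ ^ 2 ∂μ) := by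
  have h1 : |∫ x, ⟪a x, w x⟫_ℝ ∂μ| ≤ ∫ x, ‖a x‖ * ‖w x‖ ∂μ := by
    rw [← Real.norm_eq_abs]
    refine (norm_integral_le_integral_norm _).trans (integral_mono_of_nonneg
      (ae_of_all _ fun x => norm_nonneg _) (ha.norm.integrable_mul hw.norm)
      (ae_of_all _ fun x => norm_inner_le_norm _ _))
  have h2 := integral_mul_le_Lp_mul_Lq_of_nonneg Real.HolderConjugate.two_two
    (ae_of_all _ fun x => norm_nonneg (a x)) (ae_of_all _ fun x => norm_nonneg (w x))
    (by simpa using ha.norm) (by simpa using hw.norm)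
  refine h1.trans (h2.trans_eq ?_)
  simp only [Real.rpow_two, one_div, Real.sqrt_eq_rpow]

end General

namespace Torus

variable {d : Type*} [Fintype d]

/-! ## Vanishing Fourier modes from weak convergence -/

/-- **Weak convergence to zero gives vanishing Fourier modes**: if `∫ r_a · w → 0` along `l` for
every *continuous* real `w` on `T^d`, and the `r_a` are integrable, then every Fourier coefficient
of `r_a` tends to zero (test against the real and imaginary parts of the characters;
Cheskidov 2023, (3.9)–(3.10)). [folklore] -/
theorem tendsto_mFourierCoeff_of_tendsto_integral_mul {ι : Type*} {l : Filter ι}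
    {r : ι → UnitAddTorus d → ℝ} (hr : ∀ a, Integrable (r a) volume)
    (hw : ∀ w : UnitAddTorus d → ℝ, Continuous w →
      Tendsto (fun a => ∫ y, r a y * w y) l (𝓝 0)) (k : d → ℤ) :
    Tendsto (fun a => mFourierCoeff (fun y => (r a y : ℂ)) k) l (𝓝 0) := by
  set c : UnitAddTorus d → ℂ := fun y => mFourier (-k) y with hc
  have hcc : Continuous c := (mFourier (-k)).continuous
  have heq : ∀ a, mFourierCoeff (fun y => (r a y : ℂ)) k =
      ((∫ y, r a y * (c y).re : ℝ) : ℂ) + ((∫ y, r a y * (c y).im : ℝ) : ℂ) * Complex.I := by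
    intro a
    have i1 : Integrable (fun y => r a y * (c y).re) volume :=
      (hr a).mul_bdd (c := 1) (Complex.continuous_re.comp hcc).aestronglyMeasurable (ae_of_all _ fun y =>
        (Complex.abs_re_le_norm _).trans ((mFourier (-k)).norm_coe_le_norm y |>.trans_eq mFourier_norm))
    have i2 : Integrable (fun y => r a y * (c y).im) volume :=
      (hr a).mul_bdd (c := 1) (Complex.continuous_im.comp hcc).aestronglyMeasurable (ae_of_all _ fun y =>
        (Complex.abs_im_le_norm _).trans ((mFourier (-k)).norm_coe_le_norm y |>.trans_eq mFourier_norm))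
    rw [FunctionSpaces.Torus.mFourierCoeff_eq_integral_volume, ← integral_complex_ofReal,
      ← integral_complex_ofReal,
      ← integral_mul_const, ← integral_add (i1.ofReal) ((i2.ofReal).mul_const _)]
    refine integral_congr_ae (ae_of_all _ fun y => ?_)
    simp only [smul_eq_mul, Complex.ofReal_mul]
    rw [show (mFourier (-k) y : ℂ) = c y from rfl]
    conv_lhs => rw [← Complex.re_add_im (c y)]
    ring
  simp_rw [heq]
  have h1 := hw _ (Complex.continuous_re.comp hcc)
  have h2 := hw _ (Complex.continuous_im.comp hcc)
  have h1' : Tendsto (fun a => ((∫ y, r a y * (c y).re : ℝ) : ℂ)) l (𝓝 0) := by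
    have := (Complex.continuous_ofReal.tendsto 0).comp h1
    rw [Complex.ofReal_zero] at this
    exact this
  have h2' : Tendsto (fun a => ((∫ y, r a y * (c y).im : ℝ) : ℂ) * Complex.I) l (𝓝 0) := by
    have := ((Complex.continuous_ofReal.tendsto 0).comp h2).mul_const Complex.I
    rw [Complex.ofReal_zero, zero_mul] at this
    exact this
  have := h1'.add h2'
  rw [add_zero] at this
  exact this

/-! ## Vanishing Fourier modes from vanishing `Ḣ⁻¹` norms -/

omit [Fintype d] in
/-- A nonzero frequency has positive `freqNormSq`. [folklore] -/
theorem freqNormSq_pos_of_ne_zero [Fintype d] {k : d → ℤ} (hk : k ≠ 0) :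
    0 < FunctionSpaces.Torus.freqNormSq k := by
  obtain ⟨i, hi⟩ : ∃ i, k i ≠ 0 := by
    by_contra h
    push Not at h
    exact hk (funext h)
  unfold FunctionSpaces.Torus.freqNormSq
  refine lt_of_lt_of_le (by positivity : (0 : ℝ) < (k i : ℝ) ^ 2) ?_
  exact Finset.single_le_sum (f := fun j => ((k j : ℝ)) ^ 2) (fun j _ => sq_nonneg _) (Finset.mem_univ i)

/-- **Fourier coefficients are controlled by the `Ḣ⁻¹` seminorm**: for `k ≠ 0`,
`‖𝓕F(k)‖ₑ ≤ ofReal (√(|k|²)) · ‖F‖_{Ḣ⁻¹}` (a single term of the series defining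
`Torus.eHomSobolevSeminorm (-1)`; Grafakos 2014, Prop. 3.2.7-type bookkeeping). [folklore] -/
theorem enorm_mFourierCoeff_le_of_ne_zero {F : Type*} [NormedAddCommGroup F] [NormedSpace ℂ F]
    (f : UnitAddTorus d → F) {k : d → ℤ} (hk : k ≠ 0) :
    ‖mFourierCoeff f k‖ₑ ≤ ENNReal.ofReal (Real.sqrt (FunctionSpaces.Torus.freqNormSq k)) *
      FunctionSpaces.Torus.eHomSobolevSeminorm (-1) f := by
  set N : ℝ := FunctionSpaces.Torus.freqNormSq k with hN
  have hNpos : 0 < N := freqNormSq_pos_of_ne_zero hk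
  set T : ℝ≥0∞ := ∑' j : d → ℤ, (if j = 0 then 0 else ENNReal.ofReal (FunctionSpaces.Torus.freqNormSq j ^ (-1 : ℝ))) *
    ‖mFourierCoeff f j‖ₑ ^ 2 with hT
  have hS : FunctionSpaces.Torus.eHomSobolevSeminorm (-1) f = T ^ (1 / 2 : ℝ) := rfl
  -- the `k`-th term is bounded by the sum
  have hterm : ENNReal.ofReal (N ^ (-1 : ℝ)) * ‖mFourierCoeff f k‖ₑ ^ 2 ≤ T := by
    have := ENNReal.le_tsum (f := fun j : d → ℤ => (if j = 0 then 0 else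
      ENNReal.ofReal (FunctionSpaces.Torus.freqNormSq j ^ (-1 : ℝ))) * ‖mFourierCoeff f j‖ₑ ^ 2) k
    simpa only [if_neg hk] using this
  -- multiply by `N`
  have hsq : ‖mFourierCoeff f k‖ₑ ^ 2 ≤ ENNReal.ofReal N * T := by
    have hmul : ENNReal.ofReal N * (ENNReal.ofReal (N ^ (-1 : ℝ)) * ‖mFourierCoeff f k‖ₑ ^ 2) ≤
        ENNReal.ofReal N * T := by gcongr
    rw [← mul_assoc, ← ENNReal.ofReal_mul hNpos.le, show N * N ^ (-1 : ℝ) = 1 by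
      rw [Real.rpow_neg_one, mul_inv_cancel₀ hNpos.ne'], ENNReal.ofReal_one, one_mul] at hmul
    exact hmul
  -- take square roots
  have h := ENNReal.rpow_le_rpow hsq (by norm_num : (0 : ℝ) ≤ 1 / 2)
  rw [show ‖mFourierCoeff f k‖ₑ ^ 2 = ‖mFourierCoeff f k‖ₑ ^ ((2 : ℕ) : ℝ) by rw [ENNReal.rpow_natCast],
    ← ENNReal.rpow_mul, show ((2 : ℕ) : ℝ) * (1 / 2) = 1 by norm_num, ENNReal.rpow_one,
    ENNReal.mul_rpow_of_nonneg _ _ (by norm_num : (0 : ℝ) ≤ 1 / 2), ← hS] at h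
  refine h.trans_eq ?_
  congr 1
  rw [Real.sqrt_eq_rpow, ENNReal.ofReal_rpow_of_nonneg hNpos.le (by norm_num)]

/-- **Vanishing `Ḣ⁻¹` norms with vanishing means give vanishing Fourier modes** (Cheskidov 2023,
(3.6) and (3.9): `‖ρ̃^m(t)‖_{Ḣ⁻¹} ≤ Cλ_m⁻¹` and zero mean, hence `ρ ⇀ 0`). [cite: Cheskidov2023, (3.6) and (3.9)] -/
theorem tendsto_mFourierCoeff_of_tendsto_eHomSobolevSeminorm {ι : Type*} {l : Filter ι}
    {F : Type*} [NormedAddCommGroup F] [NormedSpace ℂ F] {f : ι → UnitAddTorus d → F}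
    (hS : Tendsto (fun a => FunctionSpaces.Torus.eHomSobolevSeminorm (-1) (f a)) l (𝓝 0))
    (h0 : Tendsto (fun a => mFourierCoeff (f a) 0) l (𝓝 0)) (k : d → ℤ) :
    Tendsto (fun a => mFourierCoeff (f a) k) l (𝓝 0) := by
  by_cases hk : k = 0
  · subst hk; exact h0
  rw [tendsto_zero_iff_norm_tendsto_zero]
  have hb : ∀ a, ‖mFourierCoeff (f a) k‖ₑ ≤
      ENNReal.ofReal (Real.sqrt (FunctionSpaces.Torus.freqNormSq k)) *
        FunctionSpaces.Torus.eHomSobolevSeminorm (-1) (f a) := fun a =>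
    enorm_mFourierCoeff_le_of_ne_zero (f a) hk
  have hlim : Tendsto (fun a => ENNReal.ofReal (Real.sqrt (FunctionSpaces.Torus.freqNormSq k)) *
      FunctionSpaces.Torus.eHomSobolevSeminorm (-1) (f a)) l (𝓝 0) := by
    simpa using ENNReal.Tendsto.const_mul hS (Or.inr ENNReal.ofReal_ne_top)
  have hen : Tendsto (fun a => ‖mFourierCoeff (f a) k‖ₑ) l (𝓝 0) :=
    tendsto_of_tendsto_of_tendsto_of_le_of_le tendsto_const_nhds hlim (fun _ => zero_le) hb
  have := (ENNReal.tendsto_toReal ENNReal.zero_ne_top).comp hen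
  rw [ENNReal.toReal_zero] at this
  exact this.congr fun a => by simp

/-! ## Energies of jointly smooth fields are continuous in time -/

/-- The energy `t ↦ ∫ ‖u(t)‖²` of a jointly smooth field is continuous on a convex time set. [folklore] -/
theorem _root_.Literature.Analysis.FunctionSpaces.Torus.IsSmoothSpaceTimeOn.continuousOn_integral_norm_sq
    {G : Type*} [NormedAddCommGroup G] [InnerProductSpace ℝ G] {S : Set ℝ}
    {u : ℝ → UnitAddTorus d → G} (hu : FunctionSpaces.Torus.IsSmoothSpaceTimeOn S u) (hS : Convex ℝ S) :
    ContinuousOn (fun t => ∫ x, ‖u t x‖ ^ 2) S := by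
  have h : FunctionSpaces.Torus.IsSmoothSpaceTimeOn S (fun t x => ‖u t x‖ ^ 2) := by
    change ContDiffOn ℝ _ (fun z => ‖FunctionSpaces.Torus.stLift u z‖ ^ 2) _
    exact hu.norm_sq ℝ
  exact h.continuousOn_integral hS

variable [DecidableEq d]

/-- The scalar enstrophy `t ↦ ‖∇θ(t)‖²_{L²}` (`Torus.scalarGradNormSq`) of a jointly smooth scalar
is continuous on a convex time set with unique one-sided derivatives. [folklore] -/
theorem _root_.Literature.Analysis.FunctionSpaces.Torus.IsSmoothSpaceTimeOn.continuousOn_scalarGradNormSq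
    {S : Set ℝ} {θ : ℝ → UnitAddTorus d → ℝ}
    (hθ : FunctionSpaces.Torus.IsSmoothSpaceTimeOn S θ) (hS : Convex ℝ S) (hU : UniqueDiffOn ℝ S) :
    ContinuousOn (fun t => scalarGradNormSq (θ t)) S := by
  have h : FunctionSpaces.Torus.IsSmoothSpaceTimeOn S
      (fun t x => ‖FunctionSpaces.Torus.gradient (θ t) x‖ ^ 2) := by
    have hg := hθ.gradient hU
    change ContDiffOn ℝ _ (fun z => ‖FunctionSpaces.Torus.stLift (fun t => FunctionSpaces.Torus.gradient (θ t)) z‖ ^ 2) _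
    exact hg.norm_sq ℝ
  exact h.continuousOn_integral hS

end Torus

end Literature.Analysis.FluidPDE

end
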